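import Summits.Ventures.HSemireg.WedgeHankelRecurrenceDual
import Summits.Ventures.HSemireg.WedgeHankelRecurrenceCompanionAlgebra

/-!
# Venture HSemireg — EULER'S DUAL BASIS AND THE TRACE FORM OF `K[X]/(m)`: for `m` monic of degree `d = t + 1` the «tails» `e_k = m /ₘ X^{k+1} = Σ_{l>k} m_l X^{l-1-k}` are the DUAL BASIS of
# the monomials for the symbol pairing `⟨a, b⟩ = [X^{d-1}] (ab mod m) = dualSeq m (ab) 0` (`dualSeq m e_k i = δ_{ik}`), `Σ_k X^k e_k = m′` (Euler), hence **the TRACE FORMULA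
# `trace M_a = dualSeq m (a·m′) 0 = [X^{d-1}] (a m′ mod m)`** for the multiplication matrices `M_a = mulResidueMat m a` of N73 («trace = residue of `a m′/m` at infinity», Euler–Jacobi ∕ Tate),
# and in particular **the impulse response of the symbol `m′/m` is the sequence of POWER SUMS: `dualSeq m m′ j = trace (M_X ^ j)`** for EVERY monic `m` over EVERY field (N80 was the split case)

HONEST FRAMING. Part of the Lean index of the computation cell `pub-hsemireg` (seat p10 gen 31, Sunday typer «UNIFORM-IN-n»).
LINEAR ALGEBRA OF HANKEL (catalecticant) MATRICES and of polynomials over a field ONLY (`Polynomial.modByMonic`, `Polynomial.divByMonic`, `Polynomial.derivative`, `Matrix.trace`): no variety,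
no cohomology theory, no sheaf, no Ext group and no semiregularity map is constructed here; nothing here says that HC / HC_CM / HC_AV holds; no Literature fact is declared or used; no splitting
field, no eigenvalue and no separability hypothesis is used — the proof is Euler's polynomial identity.  Custodian versions as in `WedgeHankelSiegelIdeal` (1/3).

WHAT IS IN THE TREE.  N32 (`WedgeHankelRecurrenceDual`): `dualSeq`, `dualSeq_apply`, `dualSeq_add`, `dualSeq_smul`, `dualSeq_congr_mod`, `dualSeq_X_pow_mul`.  N73: `mulResidueMat`, `mulResidueMat_apply`.
N91 (`WedgeHankelRecurrenceCompanionAlgebra`): `mulResidueMat_one`, `mulResidueMat_X_pow`.  Mathlib: `Polynomial.modByMonic_add_div`, `modByMonic_eq_sub_mul_div`, `modByMonic_eq_self_iff`,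
`natDegree_divByMonic`, `natDegree_modByMonic_lt`, `coeff_X_pow_mul'`, `coeff_derivative`, `as_sum_range'`, `Matrix.trace_one`.
RELATED, NOT USED AND NOT RESTATED: the MATRIX-side twin of `trace_mulResidueMat_X_pow` is the PROVED Literature `Literature/Combinatorics/Enumerative/TransferMatrixMethod`
(`charpolyRev_mul_mk_trace_pow_succ`: `det(I − λA) · Σ_n tr(A^{n+1}) λ^n = −Q′(λ)` for ANY square matrix, Stanley EC1 Cor. 4.7.3 via Jacobi's formula, stated in `R⟦λ⟧`); the two meet at `A = M_X`
through N82 `charpoly_mulResidueMat_X` and the reversal `Q(λ) = λ^{t+1} m(1/λ)`.  This file is the `K[X]/(m)`-SYMBOL form (`dualSeq`, top coefficient of a residue) proved by Euler's dual basis —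
no determinant, no power series, no reversal — and adds the general `trace M_a` formula; `coeff_divByMonic_X_pow` is folklore (private copies in `Literature/Algebra/Polynomial/Subresultant` and
`Literature/NumberTheory/BelabasCohen2021/MomentSeriesPade`, not importable).
THIS FILE (namespace `Summit.Ventures.HSemireg.Wedge.HankelOuter` continued; PLAIN on N32 + N91; 0 definitions — the tails are written `m /ₘ X^(k+1)`):
* §659 `coeff_divByMonic_X_pow` (`[X^j] (p /ₘ X^n) = [X^{j+n}] p`), `dualSeq_finset_sum` (additivity), **`dualSeq_divByMonic_X_pow_succ`** (Euler's dual basis `dualSeq m (m /ₘ X^{k+1}) i = δ_{ik}`,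
  `i, k < d`), `coeff_eq_dualSeq_mul_divByMonic` (coordinates `[X^k] c = dualSeq m (c · e_k) 0` for `deg c < d`), **`sum_X_pow_mul_divByMonic_X_pow_succ`** (`Σ_{k<deg m} X^k (m /ₘ X^{k+1}) = m′`,
  any `m`), **`trace_mulResidueMat`** (`trace M_a = dualSeq m (a m′) 0`), **`trace_mulResidueMat_X_pow`** (`trace (M_X ^ j) = dualSeq m m′ j`: the power sums), `dualSeq_derivative_zero`
  (`dualSeq m m′ 0 = t + 1 = trace 1`).
Nothing Ext-side.  New names only.
-/

open Module Polynomial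
open scoped Matrix Polynomial

namespace Summit.Ventures.HSemireg.Wedge.HankelOuter

open Summit.Ventures.HSemireg.Wedge Summit.Ventures.HSemireg.Wedge.Hankel

variable (K : Type*) [Field K]

/-! ## §659. Euler's dual basis, Euler's identity `Σ_k X^k (m /ₘ X^{k+1}) = m′`, and the trace form of `K[X]/(m)` -/

/-- Coefficients of the quotient by a power of `X`: `[X^j] (p /ₘ X^n) = [X^{j+n}] p` (the quotient is the tail `Σ_{l ≥ n} p_l X^{l-n}`). -/
theorem coeff_divByMonic_X_pow (p : K[X]) (n j : ℕ) : (p /ₘ Polynomial.X ^ n).coeff j = p.coeff (j + n) := by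
  have h := Polynomial.modByMonic_add_div p (Polynomial.X ^ n)
  have h0 : (p %ₘ Polynomial.X ^ n).coeff (j + n) = 0 := by
    refine Polynomial.coeff_eq_zero_of_degree_lt ((Polynomial.degree_modByMonic_lt p (Polynomial.monic_X_pow n)).trans_le ?_)
    rw [Polynomial.degree_X_pow]
    exact_mod_cast Nat.le_add_left n j
  calc (p /ₘ Polynomial.X ^ n).coeff j = (Polynomial.X ^ n * (p /ₘ Polynomial.X ^ n)).coeff (j + n) := (Polynomial.coeff_X_pow_mul _ n j).symm
    _ = (p %ₘ Polynomial.X ^ n + Polynomial.X ^ n * (p /ₘ Polynomial.X ^ n)).coeff (j + n) := by rw [Polynomial.coeff_add, h0, zero_add]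
    _ = p.coeff (j + n) := by rw [h]

/-- Additivity of the symbol map over finite sums: `dualSeq m (Σ_i f_i) = Σ_i dualSeq m f_i` (any `m`). -/
theorem dualSeq_finset_sum {ι : Type*} (m : K[X]) (s : Finset ι) (f : ι → K[X]) : dualSeq K m (∑ i ∈ s, f i) = ∑ i ∈ s, dualSeq K m (f i) := by
  classical
  induction s using Finset.induction_on with
  | empty =>
    funext j
    simp only [Finset.sum_empty, dualSeq_apply, mul_zero, Polynomial.zero_modByMonic, Polynomial.coeff_zero, Pi.zero_apply]
  | insert a s ha ih => rw [Finset.sum_insert ha, Finset.sum_insert ha, dualSeq_add, ih]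

/-- **Euler's dual basis.** For `m` monic of degree `d` and `i, k < d`: `dualSeq m (m /ₘ X^{k+1}) i = [X^{d-1}] (X^i · e_k mod m) = δ_{ik}` with `e_k = m /ₘ X^{k+1} = Σ_{l>k} m_l X^{l-1-k}`
(for `i ≤ k` the product `X^i e_k` has degree `d - 1 - k + i ≤ d - 1` and top coefficient `m_{d+k-i}`; for `i > k`, `X^i e_k = X^{i-k-1}(m - m mod X^{k+1}) ≡ -X^{i-k-1}(m mod X^{k+1})`
has degree `< i ≤ d - 1`). -/
theorem dualSeq_divByMonic_X_pow_succ {m : K[X]} (hm : m.Monic) {i k : ℕ} (hi : i < m.natDegree) (hk : k < m.natDegree) :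
    dualSeq K m (m /ₘ Polynomial.X ^ (k + 1)) i = if i = k then 1 else 0 := by
  set d := m.natDegree with hd
  set e := m /ₘ Polynomial.X ^ (k + 1) with he
  have hed : e.natDegree = d - (k + 1) := by rw [he, Polynomial.natDegree_divByMonic m (Polynomial.monic_X_pow (k + 1)), Polynomial.natDegree_X_pow]
  rcases Nat.lt_or_ge k i with hki | hik
  · -- `k < i`: `X^i e ≡ -X^{i-k-1} (m mod X^{k+1})`
    rw [if_neg (show i ≠ k by omega)]
    set r := m %ₘ Polynomial.X ^ (k + 1) with hr
    have hre : r + Polynomial.X ^ (k + 1) * e = m := Polynomial.modByMonic_add_div m (Polynomial.X ^ (k + 1))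
    have hX1 : (Polynomial.X ^ (k + 1) : K[X]) ≠ 1 := fun h => by
      have h' := congrArg Polynomial.natDegree h
      rw [Polynomial.natDegree_X_pow, Polynomial.natDegree_one] at h'
      omega
    have hrd : r.natDegree < k + 1 := by
      have h' := Polynomial.natDegree_modByMonic_lt m (Polynomial.monic_X_pow (k + 1)) hX1
      rwa [Polynomial.natDegree_X_pow] at h'
    have hcong : m ∣ Polynomial.X ^ i * e - (-(Polynomial.X ^ (i - (k + 1)) * r)) := by
      refine ⟨Polynomial.X ^ (i - (k + 1)), ?_⟩
      have hx : (Polynomial.X : K[X]) ^ i = Polynomial.X ^ (i - (k + 1)) * Polynomial.X ^ (k + 1) := by rw [← pow_add, Nat.sub_add_cancel hki]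
      rw [hx, ← hre]
      ring
    have hdeg : (-(Polynomial.X ^ (i - (k + 1)) * r)).natDegree < m.natDegree - 1 := by
      rw [Polynomial.natDegree_neg]
      refine (Polynomial.natDegree_mul_le).trans_lt ?_
      rw [Polynomial.natDegree_X_pow]
      omega
    have hdeg' : (-(Polynomial.X ^ (i - (k + 1)) * r)).natDegree < m.natDegree := hdeg.trans_le (Nat.sub_le _ _)
    have h0 : dualSeq K m (Polynomial.X ^ i * e) 0 = dualSeq K m e i := by rw [dualSeq_X_pow_mul, zero_add]
    rw [← h0, dualSeq_congr_mod K hm hcong, dualSeq_apply, pow_zero, one_mul, (Polynomial.modByMonic_eq_self_iff hm).2 (Polynomial.degree_lt_degree hdeg')]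
    exact Polynomial.coeff_eq_zero_of_natDegree_lt hdeg
  · -- `i ≤ k`: no reduction
    have hdeg : (Polynomial.X ^ i * e).natDegree < m.natDegree := by
      refine (Polynomial.natDegree_mul_le).trans_lt ?_
      rw [Polynomial.natDegree_X_pow, hed]
      omega
    rw [dualSeq_apply, (Polynomial.modByMonic_eq_self_iff hm).2 (Polynomial.degree_lt_degree hdeg), Polynomial.coeff_X_pow_mul', if_pos (by omega), he,
      coeff_divByMonic_X_pow]
    split_ifs with h
    · subst h
      rw [show d - 1 - i + (i + 1) = d by omega]
      exact hm.coeff_natDegree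
    · exact Polynomial.coeff_eq_zero_of_natDegree_lt (by omega)

/-- Coordinates through the pairing: for `m` monic of degree `d`, `deg c < d` and `k < d`, **`[X^k] c = dualSeq m (c · (m /ₘ X^{k+1})) 0`** (expand `c = Σ_i c_i X^i` and use Euler's dual basis). -/
theorem coeff_eq_dualSeq_mul_divByMonic {m : K[X]} (hm : m.Monic) {c : K[X]} (hc : c.natDegree < m.natDegree) {k : ℕ} (hk : k < m.natDegree) :
    c.coeff k = dualSeq K m (c * (m /ₘ Polynomial.X ^ (k + 1))) 0 := by
  conv_rhs => rw [Polynomial.as_sum_range' c m.natDegree hc, Finset.sum_mul, dualSeq_finset_sum, Finset.sum_apply]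
  have : ∀ i ∈ Finset.range m.natDegree, dualSeq K m (monomial i (c.coeff i) * (m /ₘ Polynomial.X ^ (k + 1))) 0 = if i = k then c.coeff i else 0 := by
    intro i hi
    rw [← Polynomial.C_mul_X_pow_eq_monomial, mul_assoc, Polynomial.C_mul', dualSeq_smul, Pi.smul_apply, smul_eq_mul, dualSeq_X_pow_mul, zero_add,
      dualSeq_divByMonic_X_pow_succ K hm (Finset.mem_range.1 hi) hk, mul_ite, mul_one, mul_zero]
  rw [Finset.sum_congr rfl this, Finset.sum_ite_eq' (Finset.range m.natDegree) k, if_pos (Finset.mem_range.2 hk)]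

/-- **Euler's identity** `Σ_{k < deg m} X^k · (m /ₘ X^{k+1}) = m′` (any `m`: the coefficient of `X^j` on the left is `m_{j+1}` counted once for each `k ≤ j`, i.e. `(j+1) m_{j+1}`). -/
theorem sum_X_pow_mul_divByMonic_X_pow_succ (m : K[X]) :
    ∑ k ∈ Finset.range m.natDegree, Polynomial.X ^ k * (m /ₘ Polynomial.X ^ (k + 1)) = derivative m := by
  ext j
  rw [Polynomial.finsetSum_coeff, Polynomial.coeff_derivative]
  have hterm : ∀ k ∈ Finset.range m.natDegree, (Polynomial.X ^ k * (m /ₘ Polynomial.X ^ (k + 1))).coeff j = if k ≤ j then m.coeff (j + 1) else 0 := by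
    intro k _
    rw [Polynomial.coeff_X_pow_mul']
    split_ifs with h
    · rw [coeff_divByMonic_X_pow, show j - k + (k + 1) = j + 1 by omega]
    · rfl
  rw [Finset.sum_congr rfl hterm, Finset.sum_ite, Finset.sum_const_zero, add_zero, Finset.sum_const, nsmul_eq_mul]
  by_cases hj : j + 1 ≤ m.natDegree
  · have : (Finset.range m.natDegree).filter (fun k => k ≤ j) = Finset.range (j + 1) := by
      ext k
      simp only [Finset.mem_filter, Finset.mem_range]
      omega
    rw [this, Finset.card_range, mul_comm]
    push_cast
    ring
  · rw [Polynomial.coeff_eq_zero_of_natDegree_lt (by omega), mul_zero, zero_mul]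

/-- **The trace formula (Euler–Jacobi ∕ Tate): `trace M_a = dualSeq m (a · m′) 0 = [X^{d-1}] (a m′ mod m)`** for the multiplication matrix `M_a = mulResidueMat m a` of `K[X]/(m)`, `m` monic of
degree `t + 1`, ANY field: the diagonal entry `[X^k] (X^k a mod m)` is `dualSeq m (X^k a · e_k) 0` by the coordinate formula, and `Σ_k X^k e_k = m′` by Euler's identity. -/
theorem trace_mulResidueMat {t : ℕ} {m : K[X]} (hm : m.Monic) (hmd : m.natDegree = t + 1) (a : K[X]) :
    (mulResidueMat K t m a).trace = dualSeq K m (a * derivative m) 0 := by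
  have hm1 : m ≠ 1 := fun h => by simp [h] at hmd
  have hdiag : ∀ k : Fin (t + 1), (mulResidueMat K t m a) k k = dualSeq K m (a * (Polynomial.X ^ (k : ℕ) * (m /ₘ Polynomial.X ^ ((k : ℕ) + 1)))) 0 := by
    intro k
    have hk : (k : ℕ) < m.natDegree := lt_of_lt_of_eq k.isLt hmd.symm
    have hc : (Polynomial.X ^ (k : ℕ) * a %ₘ m).natDegree < m.natDegree := Polynomial.natDegree_modByMonic_lt _ hm hm1
    rw [mulResidueMat_apply, coeff_eq_dualSeq_mul_divByMonic K hm hc hk]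
    refine congrFun (dualSeq_congr_mod K hm ?_) 0
    refine ⟨-(Polynomial.X ^ (k : ℕ) * a /ₘ m) * (m /ₘ Polynomial.X ^ ((k : ℕ) + 1)), ?_⟩
    have h := Polynomial.modByMonic_eq_sub_mul_div (Polynomial.X ^ (k : ℕ) * a) m
    rw [h]
    ring
  rw [Matrix.trace, Finset.sum_congr rfl (fun k _ => by rw [Matrix.diag_apply, hdiag k]), ← Finset.sum_apply, ← dualSeq_finset_sum, ← Finset.mul_sum,
    Fin.sum_univ_eq_sum_range (fun k => Polynomial.X ^ k * (m /ₘ Polynomial.X ^ (k + 1))) (t + 1), ← hmd, sum_X_pow_mul_divByMonic_X_pow_succ]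

/-- **Trace form of the impulse response: `trace (M_X ^ j) = dualSeq m m′ j`** — the symbol `m′/m` expands into the POWER SUMS of `K[X]/(m)` (`m` monic of degree `t + 1`, any field; with N91
`M_X ^ j = M_{X^j}`).  N80 `dualSeq_prod_X_sub_C_derivative` is the split case `Σ_i λ_i^j`. -/
theorem trace_mulResidueMat_X_pow {t : ℕ} {m : K[X]} (hm : m.Monic) (hmd : m.natDegree = t + 1) (j : ℕ) :
    ((mulResidueMat K t m Polynomial.X) ^ j).trace = dualSeq K m (derivative m) j := by
  rw [← mulResidueMat_X_pow K hm hmd, trace_mulResidueMat K hm hmd, dualSeq_X_pow_mul, zero_add]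

/-- `dualSeq m m′ 0 = t + 1` (`= trace M_1 = trace 1`; directly: the top coefficient of `m′` is `deg m`). -/
theorem dualSeq_derivative_zero {t : ℕ} {m : K[X]} (hm : m.Monic) (hmd : m.natDegree = t + 1) : dualSeq K m (derivative m) 0 = (t + 1 : K) := by
  rw [← one_mul (derivative m), ← trace_mulResidueMat K hm hmd, mulResidueMat_one K hm hmd, Matrix.trace_one, Fintype.card_fin, Nat.cast_add, Nat.cast_one]

end Summit.Ventures.HSemireg.Wedge.HankelOuter
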